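import Summits.Ventures.Crystal3D.Theorems.StickyWulffConstantGenericWallFloorExitCountWindow
import Summits.Ventures.Crystal3D.Theorems.StickyWulffConstantGenericWallFloorSealing
import HarnessLib

/-!
# Height-restricted exit counts in the two-slab cell: grain lines end below the other clamp window

HONEST FRAMING. Part of the venture `Summits/Ventures/Crystal3D` (cell `crystal3d-full`), helper for the
crux `CoaxialWallLaw` (stmt-Ventures-19481) of `route-Ventures-StickyWulffConstant`, REGISTERED line
`WallLedgerF` (planner cf-p1 gen 16), stub `stub_coaxialTwoSlabAdhesion : CoaxialTwoSlabAdhesion` (THE CRUX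
of the line).  Brick F-N1 of the general-filling architecture for the CO-AXIAL cell (19481-p1 g3's reading
of lane G's «monotone Barlow lines»): the SOURCES of the flux of steep grain lines, now WITH THEIR HEIGHT.
Rung credit only; F-C1 not moved.

An EXIT of the grain `Λ = A·Λ₀ + t` in `X` along the slot `u` is a ball `e ∈ X` whose predecessor
`e − A u ∈ X` carries its full shell while `e` lacks a slot (`…ExitCount`).  Lane G counts ALL exits
(`card_exits_ge`, `card_exits_ge_window`); for the co-axial cell this is not enough: for a translation pair
(`A₁·Λ₀ = A₂·Λ₀`) the complete TOP sample produces `∼ π ρ²` spurious exits of grain 1 at the container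
ceiling.  Here the exits supplied by the flux argument are located: they are LATTICE exits (`e ∈ Λ`, on the
forward `u`-ray of an inner sample ball), and a lattice ball of `X` that is not a ball of the other sample
cannot sit inside the other clamp window off the rim (`sealing_above` / `sealing_below`).

* `card_lattice_exits_ge_window` — window-agnostic source count with `e ∈ Λ` in the filter: for a sample
  `P ⊆ X` complete in `[a, a + R] × disc ρ` (`3 ≤ R ≤ ρ`) and any slot `u`, the LATTICE exits along `u`
  number `≥ √2 |⟪A u, e₃⟫| π (ρ − 1)² − 10 √2 π (ρ − 1)` (proof of `card_exits_ge_window` with the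
  forward-ray run-top injection `card_runTops_le`).
* `card_exits_below_ge` — in the cell of `CoaxialTwoSlabAdhesion` / `TwoSlabAdhesion` (`X` `1`-separated
  in `{−2R₀ ≤ x₂ ≤ h + 2R₀, lateral ≤ ρ}`, `3 ≤ R₀ ≤ ρ`, bottom sample `P₁ ⊆ Λ₁` complete in
  `[−2R₀, −R₀]`, top sample `P₂ ⊆ Λ₂` complete in `[h + R₀, h + 2R₀]`, ANY filling, ANY pair of grains):
  the lattice exits `e` of grain 1 along `u` with `e₂ < h + R₀ + 1` OR `e ∈ P₂` number at least
  `√2 |⟪A₁ u, e₃⟫| π (ρ − 1)² − 10 √2 π (ρ − 1) − 36 (R₀ + 1) ρ` (the rest sit in the rim shell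
  `{lateral > (ρ − 1)²} × [h + R₀ + 1, h + 2R₀]`, `card_rim_window_le`).
* `card_exits_above_ge` — the mirror for grain 2 (top sample, exits with `−R₀ − 1 < e₂` or `e ∈ P₁`).
* `card_exits_below_ge_of_disjoint`, `card_exits_above_ge_of_disjoint` — for grains with DISJOINT point
  sets (`Λ₁ ∩ Λ₂ = ∅`: non-CSL twins, translation pairs) the alternative `e ∈ P₂` (resp. `e ∈ P₁`) is void:
  `#{u-exits e of grain 1 with e₂ < h + R₀ + 1} ≥ √2 |⟪A₁ u, e₃⟫| π (ρ − 1)² − 10 √2 π (ρ − 1) − 36 (R₀ + 1) ρ`.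

WHAT THIS IS NOT: not the stub (the located exits still have to be paid or followed through twin caps —
bricks F-N2/F-N3); F-C1 not moved.
-/

noncomputable section

namespace Summit.Ventures.Crystal3D.Theorems

open Summit.Ventures.Crystal3D Finset
open Literature.MathematicalPhysics.StatisticalMechanics (fccStacking)
open scoped InnerProductSpace

/-- Forward rays of a moved lattice along a slot stay on the lattice: `p ∈ A·Λ₀ + t`, `w ∈ Λ₀`
`⇒ p + m • A w ∈ A·Λ₀ + t` for every `m : ℕ`. -/
theorem movedFcc_add_nsmul_site_mem
    (A : EuclideanSpace ℝ (Fin 3) ≃ₗᵢ[ℝ] EuclideanSpace ℝ (Fin 3)) (t : EuclideanSpace ℝ (Fin 3))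
    {p w : EuclideanSpace ℝ (Fin 3)} (hp : p ∈ (fun q => A q + t) '' fccStacking 1 (Real.sqrt (2 / 3)))
    (hw : w ∈ fccStacking 1 (Real.sqrt (2 / 3))) (m : ℕ) :
    p + ((m : ℕ) : ℝ) • A w ∈ (fun q => A q + t) '' fccStacking 1 (Real.sqrt (2 / 3)) := by
  induction m with
  | zero => simpa using hp
  | succ m ih =>
    have : p + ((m + 1 : ℕ) : ℝ) • A w = (p + ((m : ℕ) : ℝ) • A w) + A w := by
      push_cast; rw [add_smul, one_smul, add_assoc]
    rw [this]
    exact movedFcc_add_site_mem A t ih hw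

open scoped Classical in
/-- **Lattice exits are at least a flux (any window).**  For a sample `P ⊆ X` complete in
`[a, a + R] × disc ρ` (`3 ≤ R ≤ ρ`) of the grain `Λ = A·Λ₀ + t` and any slot `u`, the exits `e ∈ X ∩ Λ`
along `u` (predecessor `e − A u ∈ X` with full shell, `e` lacking a slot) number at least
`√2 |⟪A u, e₃⟫| π (ρ − 1)² − 10 √2 π (ρ − 1)`.  Same mechanism as `card_exits_ge_window`, with the
forward-ray run-top injection `card_runTops_le`, which remembers that the exit lies on the `u`-ray of an
inner sample ball and hence on `Λ`. -/
theorem card_lattice_exits_ge_window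
    (A : EuclideanSpace ℝ (Fin 3) ≃ₗᵢ[ℝ] EuclideanSpace ℝ (Fin 3)) (t : EuclideanSpace ℝ (Fin 3))
    (X P : Finset (EuclideanSpace ℝ (Fin 3))) (a R ρ : ℝ) (hR : 3 ≤ R) (hρ : R ≤ ρ) (hPX : P ⊆ X)
    (hP : ∀ p, p ∈ P ↔ (p ∈ (fun q => A q + t) '' fccStacking 1 (Real.sqrt (2 / 3)) ∧
      a ≤ p 2 ∧ p 2 ≤ a + R ∧ p 0 ^ 2 + p 1 ^ 2 ≤ ρ ^ 2))
    {u : EuclideanSpace ℝ (Fin 3)} (hu : u ∈ fccSlots) :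
    Real.sqrt 2 * |⟪A u, EuclideanSpace.single (2 : Fin 3) (1 : ℝ)⟫_ℝ| * Real.pi * (ρ - 1) ^ 2 -
        10 * Real.sqrt 2 * Real.pi * (ρ - 1) ≤
      (((X.filter fun e => e ∈ (fun q => A q + t) '' fccStacking 1 (Real.sqrt (2 / 3)) ∧
          e - A u ∈ X ∧ (∀ w ∈ fccSlots, e - A u + A w ∈ X) ∧
          ∃ v ∈ fccSlots, e + A v ∉ X).card : ℕ) : ℝ) := by
  have hρ1 : (1 : ℝ) ≤ ρ := by linarith
  obtain ⟨D, hD⟩ : ∃ D : Finset (EuclideanSpace ℝ (Fin 3)),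
      D = X.filter (fun q => ∀ w ∈ fccSlots, q + A w ∈ X) := ⟨_, rfl⟩
  obtain ⟨P', hP'def⟩ : ∃ P' : Finset (EuclideanSpace ℝ (Fin 3)), P' = P.filter (fun p =>
      a + 1 ≤ p 2 ∧ p 2 ≤ a + R - 1 ∧ p 0 ^ 2 + p 1 ^ 2 ≤ (ρ - 1) ^ 2) := ⟨_, rfl⟩
  have hP' : ∀ p, p ∈ P' ↔ (p ∈ (fun q => A q + t) '' fccStacking 1 (Real.sqrt (2 / 3)) ∧
      (a + 1) ≤ p 2 ∧ p 2 ≤ (a + 1) + (R - 2) ∧ p 0 ^ 2 + p 1 ^ 2 ≤ (ρ - 1) ^ 2) := by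
    intro p
    rw [hP'def, mem_filter, hP]
    constructor
    · rintro ⟨⟨hΛ, -, -, -⟩, h1, h2, h3⟩
      exact ⟨hΛ, h1, by linarith, h3⟩
    · rintro ⟨hΛ, h1, h2, h3⟩
      have hρ0 : (0 : ℝ) ≤ ρ - 1 := by linarith
      refine ⟨⟨hΛ, by linarith, by linarith, ?_⟩, h1, by linarith, h3⟩
      nlinarith
  have hP'D : P' ⊆ D := by
    intro p hp
    obtain ⟨hΛ, h1, h2, h3⟩ := (hP' p).1 hp
    rw [hD, mem_filter]
    refine ⟨hPX ((hP _).2 ?_),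
      fun w hw => hPX (inner_sample_full_window A t P a (a + R) ρ hρ1 hP hΛ h1 (by linarith) h3 hw)⟩
    have hρ0 : (0 : ℝ) ≤ ρ - 1 := by linarith
    exact ⟨hΛ, by linarith, by linarith, by nlinarith⟩
  obtain ⟨Ea, Eb, hEa, hEb, hdet, hframe, -⟩ := exists_frame_of_mem_fccSlots hu
  have h1 := tops_ge_lineCount A t (a + 1) (R - 2) (ρ - 1) (by linarith) (by linarith) P' hP'
    Ea Eb u hEa hEb (norm_eq_one_of_mem_fccSlots hu) hdet hframe
  have hu0 : A u ≠ 0 := by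
    intro h0
    have : ‖A u‖ = 0 := by rw [h0, norm_zero]
    rw [LinearIsometryEquiv.norm_map, norm_eq_one_of_mem_fccSlots hu] at this
    norm_num at this
  have hP'eq : ∀ p, p ∈ P' ↔ (p ∈ (fun q => A q + t) '' fccStacking 1 (Real.sqrt (2 / 3)) ∧
      (a + 1) ≤ p 2 ∧ p 2 ≤ a + R - 1 ∧ p 0 ^ 2 + p 1 ^ 2 ≤ (ρ - 1) ^ 2) := by
    intro p; rw [hP' p, show a + 1 + (R - 2) = a + R - 1 by ring]
  have h2 := card_runTops_le D P' (A u) hu0 hP'D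
    (runConvex_clampedSample A t (a + 1) (a + R - 1) (ρ - 1) (by linarith) P' hP'eq
      (mem_fcc_of_mem_fccSlots hu))
  have h2' : (P'.filter fun p => p + A u ∉ P').card ≤
      (D.filter fun q => q + A u ∉ D ∧ ∃ p ∈ P', ∃ m : ℕ, q = p + ((m : ℕ) : ℝ) • A u).card := by
    convert h2 using 3
  -- successors of these tops are distinct LATTICE exits
  have h3 : (D.filter fun q => q + A u ∉ D ∧ ∃ p ∈ P', ∃ m : ℕ, q = p + ((m : ℕ) : ℝ) • A u).card ≤
      (X.filter fun e => e ∈ (fun q => A q + t) '' fccStacking 1 (Real.sqrt (2 / 3)) ∧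
        e - A u ∈ X ∧ (∀ w ∈ fccSlots, e - A u + A w ∈ X) ∧
        ∃ v ∈ fccSlots, e + A v ∉ X).card := by
    refine Finset.card_le_card_of_injOn (fun q => q + A u) ?_ ?_
    · intro q hq
      rw [Finset.mem_coe, mem_filter] at hq
      obtain ⟨hqD, hnot, p, hpP', m, hqpm⟩ := hq
      rw [hD, mem_filter] at hqD
      obtain ⟨hqX, hfull⟩ := hqD
      have heX : q + A u ∈ X := hfull u hu
      have hpΛ := ((hP' p).1 hpP').1
      have heΛ : q + A u ∈ (fun q => A q + t) '' fccStacking 1 (Real.sqrt (2 / 3)) := by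
        have := movedFcc_add_nsmul_site_mem A t hpΛ (mem_fcc_of_mem_fccSlots hu) (m + 1)
        have e : p + ((m + 1 : ℕ) : ℝ) • A u = q + A u := by
          rw [hqpm]; push_cast; rw [add_smul, one_smul, add_assoc]
        rwa [e] at this
      rw [Finset.mem_coe, mem_filter]
      refine ⟨heX, heΛ, by rw [add_sub_cancel_right]; exact hqX,
        fun w hw => by rw [add_sub_cancel_right]; exact hfull w hw, ?_⟩
      by_contra hall
      push Not at hall
      apply hnot
      rw [hD, mem_filter]
      exact ⟨heX, hall⟩
    · intro q _ q' _ h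
      exact add_right_cancel h
  have h1' : Real.sqrt 2 * |⟪A u, EuclideanSpace.single (2 : Fin 3) (1 : ℝ)⟫_ℝ| * Real.pi * (ρ - 1) ^ 2 -
      10 * Real.sqrt 2 * Real.pi * (ρ - 1) ≤ (((P'.filter fun p => p + A u ∉ P').card : ℕ) : ℝ) := by
    convert h1 using 3
  have hcast : (((P'.filter fun p => p + A u ∉ P').card : ℕ) : ℝ) ≤
      (((X.filter fun e => e ∈ (fun q => A q + t) '' fccStacking 1 (Real.sqrt (2 / 3)) ∧
        e - A u ∈ X ∧ (∀ w ∈ fccSlots, e - A u + A w ∈ X) ∧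
        ∃ v ∈ fccSlots, e + A v ∉ X).card : ℕ) : ℝ) := by
    exact_mod_cast h2'.trans h3
  exact h1'.trans hcast

/-- **Packing count of a rim shell.**  In a `1`-separated `X`, the balls in the window shell
`[a, b] × {(ρ − 1)² < lateral ≤ ρ²}` (`a ≤ b`, `2 ≤ ρ`) number at most `6 (b − a + 2) (6ρ − 3)`
(`card_mul_le_of_separated_in_shell`). -/
theorem card_rim_window_le (X : Finset (EuclideanSpace ℝ (Fin 3))) (a b ρ : ℝ) (hab : a ≤ b)
    (hρ : 2 ≤ ρ) (hX : ∀ p ∈ X, ∀ q ∈ X, p ≠ q → 1 ≤ dist p q)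
    (S : Finset (EuclideanSpace ℝ (Fin 3))) (hSX : S ⊆ X)
    (hS : ∀ p ∈ S, a ≤ p 2 ∧ p 2 ≤ b ∧ (ρ - 1) ^ 2 < p 0 ^ 2 + p 1 ^ 2 ∧ p 0 ^ 2 + p 1 ^ 2 ≤ ρ ^ 2) :
    (S.card : ℝ) ≤ 6 * (b - a + 2) * (6 * ρ - 3) := by
  have hsep : ∀ p ∈ S, ∀ q ∈ S, p ≠ q → 1 ≤ dist p q :=
    fun p hp q hq hpq => hX p (hSX hp) q (hSX hq) hpq
  have key := card_mul_le_of_separated_in_shell S hsep a b (ρ - 1) ρ hab (by linarith) (by linarith) hS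
  have e : (b - a + 2) * (Real.pi * (ρ + 1) ^ 2 - Real.pi * (ρ - 1 - 1) ^ 2) =
      (Real.pi / 6) * (6 * (b - a + 2) * (6 * ρ - 3)) := by ring
  rw [e] at key
  have hπ : 0 < Real.pi / 6 := by positivity
  exact le_of_mul_le_mul_right (by linarith [key]) hπ

open scoped Classical in
/-- **Exits of the bottom grain end below the top clamp window (F-N1).**  In the cell of
`CoaxialTwoSlabAdhesion` (`X` `1`-separated in `{−2R₀ ≤ x₂ ≤ h + 2R₀, lateral ≤ ρ}`, `3 ≤ R₀ ≤ ρ`; bottom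
sample `P₁ ⊆ X` complete for `Λ₁ = A₁·Λ₀ + t₁` in `[−2R₀, −R₀]`, top sample `P₂ ⊆ X` complete for
`Λ₂ = A₂·Λ₀ + t₂` in `[h + R₀, h + 2R₀]`; no hypothesis on the filling or on the pair of grains) and for
any slot `u`, the lattice exits `e ∈ X ∩ Λ₁` of grain 1 along `u` with `e₂ < h + R₀ + 1` or `e ∈ P₂`
number at least `√2 |⟪A₁ u, e₃⟫| π (ρ − 1)² − 10 √2 π (ρ − 1) − 36 (R₀ + 1) ρ`: a lattice exit that is
not a ball of `P₂` cannot lie in `[h + R₀ + 1, h + 2R₀] × disc (ρ − 1)` (`sealing_above`), and the high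
rim shell holds at most `36 (R₀ + 1) ρ` balls (`card_rim_window_le`). -/
theorem card_exits_below_ge
    (A₁ : EuclideanSpace ℝ (Fin 3) ≃ₗᵢ[ℝ] EuclideanSpace ℝ (Fin 3)) (t₁ : EuclideanSpace ℝ (Fin 3))
    (A₂ : EuclideanSpace ℝ (Fin 3) ≃ₗᵢ[ℝ] EuclideanSpace ℝ (Fin 3)) (t₂ : EuclideanSpace ℝ (Fin 3))
    (X P₁ P₂ : Finset (EuclideanSpace ℝ (Fin 3))) (R₀ h ρ : ℝ) (hR₀ : 3 ≤ R₀) (hρ : R₀ ≤ ρ)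
    (hX : ∀ p ∈ X, ∀ q ∈ X, p ≠ q → 1 ≤ dist p q)
    (hcell : ∀ p ∈ X, -(2 * R₀) ≤ p 2 ∧ p 2 ≤ h + 2 * R₀ ∧ p 0 ^ 2 + p 1 ^ 2 ≤ ρ ^ 2)
    (hP₁X : P₁ ⊆ X) (hP₂X : P₂ ⊆ X)
    (hP₁ : ∀ p, p ∈ P₁ ↔ (p ∈ (fun q => A₁ q + t₁) '' fccStacking 1 (Real.sqrt (2 / 3)) ∧
      -(2 * R₀) ≤ p 2 ∧ p 2 ≤ -R₀ ∧ p 0 ^ 2 + p 1 ^ 2 ≤ ρ ^ 2))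
    (hP₂ : ∀ p, p ∈ P₂ ↔ (p ∈ (fun q => A₂ q + t₂) '' fccStacking 1 (Real.sqrt (2 / 3)) ∧
      h + R₀ ≤ p 2 ∧ p 2 ≤ h + 2 * R₀ ∧ p 0 ^ 2 + p 1 ^ 2 ≤ ρ ^ 2))
    {u : EuclideanSpace ℝ (Fin 3)} (hu : u ∈ fccSlots) :
    Real.sqrt 2 * |⟪A₁ u, EuclideanSpace.single (2 : Fin 3) (1 : ℝ)⟫_ℝ| * Real.pi * (ρ - 1) ^ 2 -
        10 * Real.sqrt 2 * Real.pi * (ρ - 1) - 36 * (R₀ + 1) * ρ ≤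
      (((X.filter fun e => e ∈ (fun q => A₁ q + t₁) '' fccStacking 1 (Real.sqrt (2 / 3)) ∧
          (e - A₁ u ∈ X ∧ (∀ w ∈ fccSlots, e - A₁ u + A₁ w ∈ X) ∧ ∃ v ∈ fccSlots, e + A₁ v ∉ X) ∧
          (e 2 < h + R₀ + 1 ∨ e ∈ P₂)).card : ℕ) : ℝ) := by
  have hρ1 : (1 : ℝ) ≤ ρ := by linarith
  -- all lattice exits
  have h0 := card_lattice_exits_ge_window A₁ t₁ X P₁ (-(2 * R₀)) R₀ ρ hR₀ hρ hP₁X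
    (by intro p; rw [hP₁ p, show -(2 * R₀) + R₀ = -R₀ by ring]) hu
  set ALL := X.filter fun e => e ∈ (fun q => A₁ q + t₁) '' fccStacking 1 (Real.sqrt (2 / 3)) ∧
      e - A₁ u ∈ X ∧ (∀ w ∈ fccSlots, e - A₁ u + A₁ w ∈ X) ∧ ∃ v ∈ fccSlots, e + A₁ v ∉ X with hALL
  set GOOD := X.filter fun e => e ∈ (fun q => A₁ q + t₁) '' fccStacking 1 (Real.sqrt (2 / 3)) ∧
      (e - A₁ u ∈ X ∧ (∀ w ∈ fccSlots, e - A₁ u + A₁ w ∈ X) ∧ ∃ v ∈ fccSlots, e + A₁ v ∉ X) ∧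
      (e 2 < h + R₀ + 1 ∨ e ∈ P₂) with hGOOD
  set RIM := X.filter fun x => h + R₀ + 1 ≤ x 2 ∧ (ρ - 1) ^ 2 < x 0 ^ 2 + x 1 ^ 2 with hRIM
  -- split: every lattice exit is good or in the high rim shell
  have hsplit : ALL ⊆ GOOD ∪ RIM := by
    intro e he
    rw [hALL, mem_filter] at he
    obtain ⟨heX, heΛ, hex⟩ := he
    rw [mem_union]
    by_cases hlow : e 2 < h + R₀ + 1
    · exact Or.inl (by rw [hGOOD, mem_filter]; exact ⟨heX, heΛ, hex, Or.inl hlow⟩)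
    by_cases heP₂ : e ∈ P₂
    · exact Or.inl (by rw [hGOOD, mem_filter]; exact ⟨heX, heΛ, hex, Or.inr heP₂⟩)
    push Not at hlow
    refine Or.inr ?_
    rw [hRIM, mem_filter]
    refine ⟨heX, hlow, ?_⟩
    by_contra hr
    push Not at hr
    exact sealing_above A₂ t₂ (h + R₀) (h + 2 * R₀) ρ hρ1 X P₂ hX hP₂X hP₂ e heX heP₂ (by linarith)
      (hcell e heX).2.1 hr
  have hRIMle : (RIM.card : ℝ) ≤ 36 * (R₀ + 1) * ρ := by
    have h1 := card_rim_window_le X (h + R₀ + 1) (h + 2 * R₀) ρ (by linarith) (by linarith) hX RIM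
      (filter_subset _ _) (fun p hp => ⟨(mem_filter.1 hp).2.1, (hcell p (mem_filter.1 hp).1).2.1,
        (mem_filter.1 hp).2.2, (hcell p (mem_filter.1 hp).1).2.2⟩)
    have e : 6 * (h + 2 * R₀ - (h + R₀ + 1) + 2) * (6 * ρ - 3) = 36 * (R₀ + 1) * ρ - 18 * (R₀ + 1) := by
      ring
    rw [e] at h1
    linarith
  have hcard : ALL.card ≤ GOOD.card + RIM.card :=
    (card_le_card hsplit).trans (card_union_le _ _)
  have hcard' : (ALL.card : ℝ) ≤ (GOOD.card : ℝ) + (RIM.card : ℝ) := by exact_mod_cast hcard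
  have h0' : Real.sqrt 2 * |⟪A₁ u, EuclideanSpace.single (2 : Fin 3) (1 : ℝ)⟫_ℝ| * Real.pi * (ρ - 1) ^ 2 -
      10 * Real.sqrt 2 * Real.pi * (ρ - 1) ≤ (ALL.card : ℝ) := by
    convert h0 using 3
  linarith

open scoped Classical in
/-- **Exits of the top grain end above the bottom clamp window (mirror of F-N1).**  Same cell; for any
slot `u`, the lattice exits `e ∈ X ∩ Λ₂` of grain 2 along `u` with `−R₀ − 1 < e₂` or `e ∈ P₁` number at
least `√2 |⟪A₂ u, e₃⟫| π (ρ − 1)² − 10 √2 π (ρ − 1) − 36 (R₀ + 1) ρ` (`sealing_below` for the bottom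
sample, `card_rim_window_le`). -/
theorem card_exits_above_ge
    (A₁ : EuclideanSpace ℝ (Fin 3) ≃ₗᵢ[ℝ] EuclideanSpace ℝ (Fin 3)) (t₁ : EuclideanSpace ℝ (Fin 3))
    (A₂ : EuclideanSpace ℝ (Fin 3) ≃ₗᵢ[ℝ] EuclideanSpace ℝ (Fin 3)) (t₂ : EuclideanSpace ℝ (Fin 3))
    (X P₁ P₂ : Finset (EuclideanSpace ℝ (Fin 3))) (R₀ h ρ : ℝ) (hR₀ : 3 ≤ R₀) (hρ : R₀ ≤ ρ)
    (hX : ∀ p ∈ X, ∀ q ∈ X, p ≠ q → 1 ≤ dist p q)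
    (hcell : ∀ p ∈ X, -(2 * R₀) ≤ p 2 ∧ p 2 ≤ h + 2 * R₀ ∧ p 0 ^ 2 + p 1 ^ 2 ≤ ρ ^ 2)
    (hP₁X : P₁ ⊆ X) (hP₂X : P₂ ⊆ X)
    (hP₁ : ∀ p, p ∈ P₁ ↔ (p ∈ (fun q => A₁ q + t₁) '' fccStacking 1 (Real.sqrt (2 / 3)) ∧
      -(2 * R₀) ≤ p 2 ∧ p 2 ≤ -R₀ ∧ p 0 ^ 2 + p 1 ^ 2 ≤ ρ ^ 2))
    (hP₂ : ∀ p, p ∈ P₂ ↔ (p ∈ (fun q => A₂ q + t₂) '' fccStacking 1 (Real.sqrt (2 / 3)) ∧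
      h + R₀ ≤ p 2 ∧ p 2 ≤ h + 2 * R₀ ∧ p 0 ^ 2 + p 1 ^ 2 ≤ ρ ^ 2))
    {u : EuclideanSpace ℝ (Fin 3)} (hu : u ∈ fccSlots) :
    Real.sqrt 2 * |⟪A₂ u, EuclideanSpace.single (2 : Fin 3) (1 : ℝ)⟫_ℝ| * Real.pi * (ρ - 1) ^ 2 -
        10 * Real.sqrt 2 * Real.pi * (ρ - 1) - 36 * (R₀ + 1) * ρ ≤
      (((X.filter fun e => e ∈ (fun q => A₂ q + t₂) '' fccStacking 1 (Real.sqrt (2 / 3)) ∧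
          (e - A₂ u ∈ X ∧ (∀ w ∈ fccSlots, e - A₂ u + A₂ w ∈ X) ∧ ∃ v ∈ fccSlots, e + A₂ v ∉ X) ∧
          (-R₀ - 1 < e 2 ∨ e ∈ P₁)).card : ℕ) : ℝ) := by
  have hρ1 : (1 : ℝ) ≤ ρ := by linarith
  have h0 := card_lattice_exits_ge_window A₂ t₂ X P₂ (h + R₀) R₀ ρ hR₀ hρ hP₂X
    (by intro p; rw [hP₂ p, show h + R₀ + R₀ = h + 2 * R₀ by ring]) hu
  set ALL := X.filter fun e => e ∈ (fun q => A₂ q + t₂) '' fccStacking 1 (Real.sqrt (2 / 3)) ∧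
      e - A₂ u ∈ X ∧ (∀ w ∈ fccSlots, e - A₂ u + A₂ w ∈ X) ∧ ∃ v ∈ fccSlots, e + A₂ v ∉ X with hALL
  set GOOD := X.filter fun e => e ∈ (fun q => A₂ q + t₂) '' fccStacking 1 (Real.sqrt (2 / 3)) ∧
      (e - A₂ u ∈ X ∧ (∀ w ∈ fccSlots, e - A₂ u + A₂ w ∈ X) ∧ ∃ v ∈ fccSlots, e + A₂ v ∉ X) ∧
      (-R₀ - 1 < e 2 ∨ e ∈ P₁) with hGOOD
  set RIM := X.filter fun x => x 2 ≤ -R₀ - 1 ∧ (ρ - 1) ^ 2 < x 0 ^ 2 + x 1 ^ 2 with hRIM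
  have hsplit : ALL ⊆ GOOD ∪ RIM := by
    intro e he
    rw [hALL, mem_filter] at he
    obtain ⟨heX, heΛ, hex⟩ := he
    rw [mem_union]
    by_cases hhigh : -R₀ - 1 < e 2
    · exact Or.inl (by rw [hGOOD, mem_filter]; exact ⟨heX, heΛ, hex, Or.inl hhigh⟩)
    by_cases heP₁ : e ∈ P₁
    · exact Or.inl (by rw [hGOOD, mem_filter]; exact ⟨heX, heΛ, hex, Or.inr heP₁⟩)
    push Not at hhigh
    refine Or.inr ?_
    rw [hRIM, mem_filter]
    refine ⟨heX, hhigh, ?_⟩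
    by_contra hr
    push Not at hr
    exact sealing_below A₁ t₁ (-(2 * R₀)) (-R₀) ρ hρ1 X P₁ hX hP₁X hP₁ e heX heP₁ (hcell e heX).1
      (by linarith) hr
  have hRIMle : (RIM.card : ℝ) ≤ 36 * (R₀ + 1) * ρ := by
    have h1 := card_rim_window_le X (-(2 * R₀)) (-R₀ - 1) ρ (by linarith) (by linarith) hX RIM
      (filter_subset _ _) (fun p hp => ⟨(hcell p (mem_filter.1 hp).1).1, (mem_filter.1 hp).2.1,
        (mem_filter.1 hp).2.2, (hcell p (mem_filter.1 hp).1).2.2⟩)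
    have e : 6 * (-R₀ - 1 - -(2 * R₀) + 2) * (6 * ρ - 3) = 36 * (R₀ + 1) * ρ - 18 * (R₀ + 1) := by
      ring
    rw [e] at h1
    linarith
  have hcard : ALL.card ≤ GOOD.card + RIM.card :=
    (card_le_card hsplit).trans (card_union_le _ _)
  have hcard' : (ALL.card : ℝ) ≤ (GOOD.card : ℝ) + (RIM.card : ℝ) := by exact_mod_cast hcard
  have h0' : Real.sqrt 2 * |⟪A₂ u, EuclideanSpace.single (2 : Fin 3) (1 : ℝ)⟫_ℝ| * Real.pi * (ρ - 1) ^ 2 -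
      10 * Real.sqrt 2 * Real.pi * (ρ - 1) ≤ (ALL.card : ℝ) := by
    convert h0 using 3
  linarith

open scoped Classical in
/-- **F-N1 for grains with disjoint point sets.**  If `Λ₁ ∩ Λ₂ = ∅` (non-CSL twin pairs, translation
pairs) then the located exits of `card_exits_below_ge` all lie below the top clamp window:
`#{u-exits e of grain 1 with e₂ < h + R₀ + 1} ≥ √2 |⟪A₁ u, e₃⟫| π (ρ − 1)² − 10 √2 π (ρ − 1) − 36 (R₀ + 1) ρ`. -/
theorem card_exits_below_ge_of_disjoint
    (A₁ : EuclideanSpace ℝ (Fin 3) ≃ₗᵢ[ℝ] EuclideanSpace ℝ (Fin 3)) (t₁ : EuclideanSpace ℝ (Fin 3))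
    (A₂ : EuclideanSpace ℝ (Fin 3) ≃ₗᵢ[ℝ] EuclideanSpace ℝ (Fin 3)) (t₂ : EuclideanSpace ℝ (Fin 3))
    (X P₁ P₂ : Finset (EuclideanSpace ℝ (Fin 3))) (R₀ h ρ : ℝ) (hR₀ : 3 ≤ R₀) (hρ : R₀ ≤ ρ)
    (hX : ∀ p ∈ X, ∀ q ∈ X, p ≠ q → 1 ≤ dist p q)
    (hcell : ∀ p ∈ X, -(2 * R₀) ≤ p 2 ∧ p 2 ≤ h + 2 * R₀ ∧ p 0 ^ 2 + p 1 ^ 2 ≤ ρ ^ 2)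
    (hP₁X : P₁ ⊆ X) (hP₂X : P₂ ⊆ X)
    (hP₁ : ∀ p, p ∈ P₁ ↔ (p ∈ (fun q => A₁ q + t₁) '' fccStacking 1 (Real.sqrt (2 / 3)) ∧
      -(2 * R₀) ≤ p 2 ∧ p 2 ≤ -R₀ ∧ p 0 ^ 2 + p 1 ^ 2 ≤ ρ ^ 2))
    (hP₂ : ∀ p, p ∈ P₂ ↔ (p ∈ (fun q => A₂ q + t₂) '' fccStacking 1 (Real.sqrt (2 / 3)) ∧
      h + R₀ ≤ p 2 ∧ p 2 ≤ h + 2 * R₀ ∧ p 0 ^ 2 + p 1 ^ 2 ≤ ρ ^ 2))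
    (hdisj : ∀ p ∈ (fun q => A₁ q + t₁) '' fccStacking 1 (Real.sqrt (2 / 3)),
      p ∉ (fun q => A₂ q + t₂) '' fccStacking 1 (Real.sqrt (2 / 3)))
    {u : EuclideanSpace ℝ (Fin 3)} (hu : u ∈ fccSlots) :
    Real.sqrt 2 * |⟪A₁ u, EuclideanSpace.single (2 : Fin 3) (1 : ℝ)⟫_ℝ| * Real.pi * (ρ - 1) ^ 2 -
        10 * Real.sqrt 2 * Real.pi * (ρ - 1) - 36 * (R₀ + 1) * ρ ≤
      (((X.filter fun e =>
          (e - A₁ u ∈ X ∧ (∀ w ∈ fccSlots, e - A₁ u + A₁ w ∈ X) ∧ ∃ v ∈ fccSlots, e + A₁ v ∉ X) ∧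
          e 2 < h + R₀ + 1).card : ℕ) : ℝ) := by
  have h0 := card_exits_below_ge A₁ t₁ A₂ t₂ X P₁ P₂ R₀ h ρ hR₀ hρ hX hcell hP₁X hP₂X hP₁ hP₂ hu
  refine h0.trans ?_
  have hsub : (X.filter fun e => e ∈ (fun q => A₁ q + t₁) '' fccStacking 1 (Real.sqrt (2 / 3)) ∧
      (e - A₁ u ∈ X ∧ (∀ w ∈ fccSlots, e - A₁ u + A₁ w ∈ X) ∧ ∃ v ∈ fccSlots, e + A₁ v ∉ X) ∧
      (e 2 < h + R₀ + 1 ∨ e ∈ P₂)) ⊆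
      (X.filter fun e =>
        (e - A₁ u ∈ X ∧ (∀ w ∈ fccSlots, e - A₁ u + A₁ w ∈ X) ∧ ∃ v ∈ fccSlots, e + A₁ v ∉ X) ∧
        e 2 < h + R₀ + 1) := by
    intro e he
    rw [mem_filter] at he ⊢
    obtain ⟨heX, heΛ, hex, hor⟩ := he
    refine ⟨heX, hex, ?_⟩
    rcases hor with hlow | heP₂
    · exact hlow
    · exact absurd ((hP₂ e).1 heP₂).1 (hdisj e heΛ)
  exact_mod_cast card_le_card hsub

open scoped Classical in
/-- **Mirror of F-N1 for grains with disjoint point sets**: the located exits of `card_exits_above_ge`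
all lie above the bottom clamp window,
`#{u-exits e of grain 2 with −R₀ − 1 < e₂} ≥ √2 |⟪A₂ u, e₃⟫| π (ρ − 1)² − 10 √2 π (ρ − 1) − 36 (R₀ + 1) ρ`. -/
theorem card_exits_above_ge_of_disjoint
    (A₁ : EuclideanSpace ℝ (Fin 3) ≃ₗᵢ[ℝ] EuclideanSpace ℝ (Fin 3)) (t₁ : EuclideanSpace ℝ (Fin 3))
    (A₂ : EuclideanSpace ℝ (Fin 3) ≃ₗᵢ[ℝ] EuclideanSpace ℝ (Fin 3)) (t₂ : EuclideanSpace ℝ (Fin 3))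
    (X P₁ P₂ : Finset (EuclideanSpace ℝ (Fin 3))) (R₀ h ρ : ℝ) (hR₀ : 3 ≤ R₀) (hρ : R₀ ≤ ρ)
    (hX : ∀ p ∈ X, ∀ q ∈ X, p ≠ q → 1 ≤ dist p q)
    (hcell : ∀ p ∈ X, -(2 * R₀) ≤ p 2 ∧ p 2 ≤ h + 2 * R₀ ∧ p 0 ^ 2 + p 1 ^ 2 ≤ ρ ^ 2)
    (hP₁X : P₁ ⊆ X) (hP₂X : P₂ ⊆ X)
    (hP₁ : ∀ p, p ∈ P₁ ↔ (p ∈ (fun q => A₁ q + t₁) '' fccStacking 1 (Real.sqrt (2 / 3)) ∧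
      -(2 * R₀) ≤ p 2 ∧ p 2 ≤ -R₀ ∧ p 0 ^ 2 + p 1 ^ 2 ≤ ρ ^ 2))
    (hP₂ : ∀ p, p ∈ P₂ ↔ (p ∈ (fun q => A₂ q + t₂) '' fccStacking 1 (Real.sqrt (2 / 3)) ∧
      h + R₀ ≤ p 2 ∧ p 2 ≤ h + 2 * R₀ ∧ p 0 ^ 2 + p 1 ^ 2 ≤ ρ ^ 2))
    (hdisj : ∀ p ∈ (fun q => A₁ q + t₁) '' fccStacking 1 (Real.sqrt (2 / 3)),
      p ∉ (fun q => A₂ q + t₂) '' fccStacking 1 (Real.sqrt (2 / 3)))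
    {u : EuclideanSpace ℝ (Fin 3)} (hu : u ∈ fccSlots) :
    Real.sqrt 2 * |⟪A₂ u, EuclideanSpace.single (2 : Fin 3) (1 : ℝ)⟫_ℝ| * Real.pi * (ρ - 1) ^ 2 -
        10 * Real.sqrt 2 * Real.pi * (ρ - 1) - 36 * (R₀ + 1) * ρ ≤
      (((X.filter fun e =>
          (e - A₂ u ∈ X ∧ (∀ w ∈ fccSlots, e - A₂ u + A₂ w ∈ X) ∧ ∃ v ∈ fccSlots, e + A₂ v ∉ X) ∧
          -R₀ - 1 < e 2).card : ℕ) : ℝ) := by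
  have h0 := card_exits_above_ge A₁ t₁ A₂ t₂ X P₁ P₂ R₀ h ρ hR₀ hρ hX hcell hP₁X hP₂X hP₁ hP₂ hu
  refine h0.trans ?_
  have hsub : (X.filter fun e => e ∈ (fun q => A₂ q + t₂) '' fccStacking 1 (Real.sqrt (2 / 3)) ∧
      (e - A₂ u ∈ X ∧ (∀ w ∈ fccSlots, e - A₂ u + A₂ w ∈ X) ∧ ∃ v ∈ fccSlots, e + A₂ v ∉ X) ∧
      (-R₀ - 1 < e 2 ∨ e ∈ P₁)) ⊆
      (X.filter fun e =>
        (e - A₂ u ∈ X ∧ (∀ w ∈ fccSlots, e - A₂ u + A₂ w ∈ X) ∧ ∃ v ∈ fccSlots, e + A₂ v ∉ X) ∧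
        -R₀ - 1 < e 2) := by
    intro e he
    rw [mem_filter] at he ⊢
    obtain ⟨heX, heΛ, hex, hor⟩ := he
    refine ⟨heX, hex, ?_⟩
    rcases hor with hhigh | heP₁
    · exact hhigh
    · exact absurd heΛ (hdisj e ((hP₁ e).1 heP₁).1)
  exact_mod_cast card_le_card hsub

end Summit.Ventures.Crystal3D.Theorems

end
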